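import Summits.ResolutionOfSingularities.ResolutionOfSingularities.Theorems.FrobeniusClosingSteerSteeredExit
import Literature.AlgebraicGeometry.Resolution.AffineDomainDimension
import HarnessLib

/-!
# Crux `Steer` (stmt-ResolutionOfSingularities-16345), line `switching_dichotomy`, σ_top-steered composition at `p = 2`:
# the CODIMENSION BOUND of a dominant tail (`TailCodimBound` of the registered skeleton r20, Theses-free body)

OURS (campaign `res-hironaka`, rung L, slot W4.1, chain W4.1, lead `res-L0-w41-lead-1` g3; replaces the role of no printed
item; NOT a statement of the manuscript under review). The chain planner's T-line for the registered σ-residual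
`stub_eternalSteeredRunTwo` (`L/w41/R2TwoSigma-r19.snippet.lean` §σ2.4, `eternalSteeredRunTwo_of`) sorts an eternal σ_top-steered
run by the codimension `c` of a dominant tail and needs `c + 1 ≤ n`: the tail centre is a NON-MAXIMAL PRIME of height `c` of a
member `R i₀` of the run, and every member is the local ring at the centre of `O` of a finitely generated model `A₁ ⊆ O` of
`K / k` (towers of local blowings up of `(A₀)_{𝔪_O ∩ A₀}` are such, `SteeredExit.exists_model_of_tower`, res-D-pv-011 p497302),
whose Krull dimension is `trdeg_k A₁ ≤ trdeg_k K = n` (`exists_ringKrullDim_eq_and_trdeg_eq`, Mathlib `trdeg_le_of_injective`);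
so `c = ht P < ht 𝔪 = dim R i₀ ≤ dim A₁ ≤ n`.

* `TailCodim.tailCodimBound_of_steeredRun` — the bound, generic in the sub-plan's permissibility predicate `Perm` (only
  «`Perm S f P → P` prime and `P ≠ 𝔪_S`» is consumed; for the sketch's `IsPermissibleCentre` these are its `IsTopSingComponent`
  field and its first field), with the run and tail clauses of `IsSteeredRun` / `IsDominantTail` UNFOLDED verbatim, so that the
  in-skeleton leaf `tailCodimBound_holds : TailCodimBound` is a definitional `exact`.

[cite: Matsumura1987, Thm. 5.6] [cite: NovacoskiSpivakovsky2014, Def. 2.8 and Lemma 2.9] [folklore]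
-/

noncomputable section

-- `Summit.<S>.<S>.…` duplicates the summit name by design (single-problem summit).
set_option linter.dupNamespace false

open IsLocalRing

namespace Summit.ResolutionOfSingularities.ResolutionOfSingularities.Theorems.SwitchingDichotomy

open Literature.AlgebraicGeometry.Resolution

namespace TailCodim

variable {k K : Type} [Field k] [Field K] [Algebra k K]

/-- **Krull dimension of the local ring at the centre of a finitely generated model**: for a finitely generated
`k`-subalgebra `A₁ ⊆ O` of `K`, `dim (A₁)_{𝔪_O ∩ A₁} ≤ trdeg_k K`. [cite: Matsumura1987, Thm. 5.6] [folklore] -/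
theorem ringKrullDim_locAtCentre_le (O : ValuationSubring K) (A₁ : Subalgebra k K) (h₁ : A₁.toSubring ≤ O.toSubring)
    (hfg : A₁.FG) {n : ℕ} (htr : Algebra.trdeg k K = n) :
    ringKrullDim (locAtCentre A₁.toSubring O) ≤ n := by
  classical
  haveI : Algebra.FiniteType k A₁ := (Subalgebra.fg_iff_finiteType A₁).mp hfg
  obtain ⟨m, hdimA, htrA⟩ := exists_ringKrullDim_eq_and_trdeg_eq k A₁
  have hmn : m ≤ n := by
    have h := trdeg_le_of_injective A₁.val Subtype.val_injective
    rw [htrA, htr] at h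
    exact_mod_cast h
  have hdimA' : ringKrullDim A₁.toSubring = m := hdimA
  rw [ringKrullDim_eq_of_ringEquiv (locAtCentreEquiv h₁).toRingEquiv.symm,
    IsLocalization.AtPrime.ringKrullDim_eq_height (subringCentre A₁.toSubring O h₁)
      (Localization.AtPrime (subringCentre A₁.toSubring O h₁))]
  calc ((subringCentre A₁.toSubring O h₁).height : WithBot ℕ∞) ≤ ringKrullDim A₁.toSubring :=
      Ideal.height_le_ringKrullDim_of_isPrime
    _ = m := hdimA'
    _ ≤ n := by exact_mod_cast hmn

/-- **`TailCodimBound`, Theses-free body**: along a σ_top-steered run of the datum `(A₀, t)` (`A₀ ⊆ O` finitely generated,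
`trdeg_k K = n`), a dominant tail of codimension `c` from stage `i₀` has `c + 1 ≤ n`. Generic in the permissibility predicate
`Perm` (consumed: a permissible centre is a prime different from the maximal ideal); the run clause is the second conjunct of
the sketch's `IsSteeredRun` and the tail clause is `IsDominantTail`, both unfolded. [cite: Matsumura1987, Thm. 5.6]
[cite: NovacoskiSpivakovsky2014, Def. 2.8 and Lemma 2.9] [folklore] -/
theorem tailCodimBound_of_steeredRun
    (Perm : ∀ S : Subring K, IsLocalRing S → S → Ideal S → Prop) (p : ℕ)
    (hPerm : ∀ (S : Subring K) (hS : IsLocalRing S) (f : S) (P : Ideal S),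
      Perm S hS f P → P.IsPrime ∧ P ≠ @maximalIdeal S _ hS)
    (O : ValuationSubring K) (A₀ : Subalgebra k K) (h₀ : A₀.toSubring ≤ O.toSubring) (hfg : A₀.FG)
    {n : ℕ} (htr : Algebra.trdeg k K = n)
    (R : ℕ → Subring K) (P : (i : ℕ) → Ideal (R i)) (s : ℕ → K)
    (hR0 : R 0 = locAtCentre A₀.toSubring O)
    (hrun : ∀ i, ∃ (hL : IsLocalRing (R i)) (hs : s i ^ p ∈ R i),
      (Perm (R i) hL ⟨s i ^ p, hs⟩ (P i) ∨
        (P i = maximalIdeal (R i) ∧ (∀ Q : Ideal (R i), ¬ Perm (R i) hL ⟨s i ^ p, hs⟩ Q) ∧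
          ∃ g : R i, (⟨s i ^ p, hs⟩ : R i) - g ^ p ∈ maximalIdeal (R i) ^ p)) ∧
      IsLocalBlowupAlong O (R i) (P i) (R (i + 1)) ∧
      ∃ x g : K, ((∃ hx : x ∈ R i, (⟨x, hx⟩ : R i) ∈ P i) ∧ x ≠ 0 ∧
        ∀ y : R i, y ∈ P i → O.valuation (y : K) ≤ O.valuation x) ∧ g ∈ R i ∧
        s i = x * s (i + 1) + g)
    (i₀ c : ℕ)
    (htail : ∀ i, i₀ ≤ i → (∃ _ : IsLocalRing (R i), P i ≠ maximalIdeal (R i)) ∧ (P i).height = c ∧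
      ∃ h : R i ≤ R (i + 1), Ideal.comap (Subring.inclusion h) (P (i + 1)) = P i) :
    c + 1 ≤ n := by
  classical
  obtain ⟨hL, hs, hC, -, -⟩ := hrun i₀
  obtain ⟨⟨hL', hne⟩, hht, -⟩ := htail i₀ le_rfl
  haveI := hL
  -- ### the tail centre at stage `i₀` is a prime strictly below the maximal ideal
  have hprime : (P i₀).IsPrime ∧ P i₀ ≠ maximalIdeal (R i₀) := by
    rcases hC with hperm | ⟨hPm, -, -⟩
    · exact hPerm _ hL _ _ hperm
    · exact absurd hPm hne
  obtain ⟨hPr, hPne⟩ := hprime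
  haveI := hPr
  have hlt : P i₀ < maximalIdeal (R i₀) := lt_of_le_of_ne (IsLocalRing.le_maximalIdeal hPr.ne_top) hPne
  -- ### `R i₀` is the local ring at the centre of a finitely generated model, so `dim (R i₀) ≤ n`
  obtain ⟨A₁, h₁, -, hfg₁, hRA⟩ := SteeredExit.exists_model_of_tower O A₀ h₀ hfg hR0 (N := i₀)
    (fun i _ => (hrun i).2.2.2.1.isLocalBlowup)
  have hdimR : ringKrullDim (R i₀) ≤ n := by
    rw [← hRA]
    exact ringKrullDim_locAtCentre_le O A₁ h₁ hfg₁ htr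
  -- ### `c = ht (P i₀) < ht 𝔪 = dim (R i₀) ≤ n`
  have hmax : ((maximalIdeal (R i₀)).height : WithBot ℕ∞) ≤ n := by
    rw [IsLocalRing.maximalIdeal_height_eq_ringKrullDim]
    exact hdimR
  have hmax' : (maximalIdeal (R i₀)).height ≤ n := by exact_mod_cast hmax
  haveI : (maximalIdeal (R i₀)).FiniteHeight :=
    Ideal.finiteHeight_iff_lt.mpr (Or.inr (lt_of_le_of_lt hmax' (ENat.coe_lt_top n)))
  have hclt : (c : ℕ∞) < n := by
    rw [← hht]
    exact lt_of_lt_of_le (Ideal.height_strict_mono_of_isPrime_of_isPrime hlt) hmax'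
  have hcn : c < n := by exact_mod_cast hclt
  omega

end TailCodim

end Summit.ResolutionOfSingularities.ResolutionOfSingularities.Theorems.SwitchingDichotomy

end
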